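import Mathlib
import Summits.KontsevichZagierPeriods.Zeta5Search.DenomLaw.ThresholdModelM1
import Summits.KontsevichZagierPeriods.Zeta5Search.DenomLaw.ThresholdModelCensusTable

/-!
# ζ(5) search — DENOM-LAW: the threshold model, PART II (the level census), part C: level sums, admissibility, deep-cell corollaries

Cell `pub-zeta5`, track DENOM-LAW (K1 typing order item (1), «ThresholdModel port»): denom-engine-d2 g12's kernel-checked scratch module
`denom-law/engine-d2/g12/lean/LevelCensus.lean` PART II (THRESHOLD-X4; Theorem S (i)/(i′) at cell level) filed VERBATIM in four parts
(≤ 400 lines each; split plan THRESHOLD-X4 §2; docstrings added where the scratch file had none) by denom-prover-d1 g5.  Part C of 4.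
HONEST FRAMING: systematic search; MODEL/structure side — elementary integer arithmetic of the level census; nothing about ζ(5); no γ; no irrationality claim; records in print UNMOVED.
The mathematical header of PART II (the census, what is proved) is the second module docstring of part A (`ThresholdModelCensus.lean`).
-/

namespace Summit.KontsevichZagierPeriods.Zeta5Search.DenomLaw.ThresholdModel.Rho

section Sums
variable {p R0 m : ℤ} {r : Fin 7 → ℤ} {u : ℤ}

/-- the level range `[−1, 3m−1]` as `Ico (−1) (3m)`; `ord`, `T_m`, `E` vanish outside it (`ord_outside`, `excess_outside`). -/
noncomputable def levels (m : ℤ) : Finset ℤ := Finset.Ico (-1) (3 * m)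

/-- Splitting a sum over `Ico a c` at `b`. -/
theorem sum_Ico_split (f : ℤ → ℤ) {a b c : ℤ} (hab : a ≤ b) (hbc : b ≤ c) :
    (∑ x ∈ Finset.Ico a c, f x) = (∑ x ∈ Finset.Ico a b, f x) + ∑ x ∈ Finset.Ico b c, f x := by
  rw [← Finset.Ico_union_Ico_eq_Ico hab hbc, Finset.sum_union (Finset.Ico_disjoint_Ico_consecutive a b c)]

/-- A sum over `Ico a b` of a function constant there. -/
theorem sum_Ico_const_of (f : ℤ → ℤ) {a b : ℤ} (v : ℤ) (hab : a ≤ b) (h : ∀ x, a ≤ x → x < b → f x = v) :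
    (∑ x ∈ Finset.Ico a b, f x) = (b - a) * v := by
  rw [Finset.sum_congr rfl (fun x hx => h x (Finset.mem_Ico.1 hx).1 (Finset.mem_Ico.1 hx).2), Finset.sum_const,
    Int.card_Ico, nsmul_eq_mul, Int.toNat_of_nonneg (by linarith)]

/-- A sum of a single indicator over a finset containing its support point. -/
theorem sum_ite_level (S : Finset ℤ) (c X : ℤ) (hc : c ∈ S) : (∑ ℓ ∈ S, if ℓ = c then X else 0) = X := by
  rw [Finset.sum_ite_eq' S c (fun _ => X), if_pos hc]

/-- `Σ_{ℓ=−1}^{3m−1} T_m(ℓ) = 6(m+1) − (m−1) − (m−1) = 4m + 8` (poles minus zeros of the symmetric pattern per class). -/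
theorem sum_Tsym (hm : 1 ≤ m) : (∑ ℓ ∈ levels m, Tsym m ℓ) = 4 * m + 8 := by
  unfold levels
  rw [sum_Ico_split _ (show (-1 : ℤ) ≤ 0 by norm_num) (by omega),
    sum_Ico_split _ (show (0 : ℤ) ≤ m - 1 by omega) (by omega),
    sum_Ico_split _ (show m - 1 ≤ 2 * m by omega) (by omega),
    sum_Ico_split _ (show 2 * m ≤ 3 * m - 1 by omega) (by omega),
    sum_Ico_const_of _ 0 (by norm_num) (fun x h0 h1 => Tsym_outside hm (Or.inl (by omega))),
    sum_Ico_const_of _ (-1) (by omega) (fun x h0 h1 => Tsym_zeroLo h0 (by omega)),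
    sum_Ico_const_of _ 6 (by omega) (fun x h0 h1 => Tsym_pole h0 (by omega)),
    sum_Ico_const_of _ (-1) (by omega) (fun x h0 h1 => Tsym_zeroHi h0 (by omega)),
    sum_Ico_const_of _ 0 (by omega) (fun x h0 h1 => Tsym_outside hm (Or.inr h0))]
  ring

/-- `Σ_ℓ (closed form) = L + R + n₊ + n₋ − [u > R₀] − [u < −R₀] − #{ρ_j ≥ 3p+u} − #{ρ_j ≥ 3p−u} = δ_A(u)`, Part I's AMENDED defect. -/
theorem sum_excessFormula (hm : 1 ≤ m) : (∑ ℓ ∈ levels m, excessFormula p R0 m r ℓ u) = deltaA p R0 r u := by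
  have mem : ∀ c, -1 ≤ c → c < 3 * m → c ∈ levels m := fun c h0 h1 => Finset.mem_Ico.2 ⟨h0, h1⟩
  unfold excessFormula
  simp only [Finset.sum_add_distrib, Finset.sum_sub_distrib]
  rw [sum_ite_level _ _ _ (mem _ (by omega) (by omega)), sum_ite_level _ _ _ (mem _ (by omega) (by omega)),
    sum_ite_level _ _ _ (mem _ (by omega) (by omega)), sum_ite_level _ _ _ (mem _ (by omega) (by omega)),
    sum_ite_level _ _ _ (mem _ (by omega) (by omega)), sum_ite_level _ _ _ (mem _ (by omega) (by omega)),
    sum_ite_level _ _ _ (mem _ (by omega) (by omega)), sum_ite_level _ _ _ (mem _ (by omega) (by omega))]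
  unfold deltaA LA RA npA nmA
  ring

/-- **`Σ_ℓ E(ℓ,u) = δ_A(u)`** for EVERY octave `m ≥ 1` and every `u ∈ [−p, p]` — admissible or not: the AMENDED defect
of Part I is the true total excess (degree of `P_x` counted with the negative exponents). -/
theorem sum_excess (h : LevelBox p R0 r) (hm : 1 ≤ m) (hu1 : -p ≤ u) (hu2 : u ≤ p) :
    (∑ ℓ ∈ levels m, excess p R0 m r ℓ u) = deltaA p R0 r u := by
  rw [Finset.sum_congr rfl (fun ℓ _ => excess_eq_formula h hm hu1 hu2 ℓ), sum_excessFormula hm]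

/-- **S3a BOOKKEEPING**: `Σ_ℓ ord(ℓ,u) = 4m + 8 − δ_A(u)` (poles minus zeros of the class inside `[−1, 3m−1]`, and
nothing outside by `ord_outside`).  With theory-d1's census weight `w_x = Z − N` (`census2`: `Z` = numerator integers of
the class `+ [centre-zero]`, `N` = block integers) this reads `w_x = δ_A(u) + [centre-zero] − (4m+8)` — SELECTION-LAW-PROOF
§3's «`w_x = −(4m+8) + δ(u_x) + [centre]`», now for every class with `δ_A` in place of `δ` (they agree on admissible classes,
`deltaA_eq_delta`). -/
theorem sum_ord (h : LevelBox p R0 r) (hm : 1 ≤ m) (hu1 : -p ≤ u) (hu2 : u ≤ p) :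
    (∑ ℓ ∈ levels m, ord p R0 m r ℓ u) = 4 * m + 8 - deltaA p R0 r u := by
  have e : ∀ ℓ, ord p R0 m r ℓ u = Tsym m ℓ - excess p R0 m r ℓ u := fun ℓ => by unfold excess; ring
  rw [Finset.sum_congr rfl (fun ℓ _ => e ℓ), Finset.sum_sub_distrib, sum_Tsym hm, sum_excess h hm hu1 hu2]

end Sums

/-! ### Admissibility («no over-covered level») and Theorem S (i) / (i′) as printed -/

section Admissible
variable {p R0 m : ℤ} {r : Fin 7 → ℤ} {ℓ u : ℤ}

/-- **`m ≥ 2`: no over-covered level ⟺ `|u| ≤ R₀` and no block reaches beyond the pole frame** (`ρ_j < 3p ∓ u` for all j)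
— theory-d1 g10's inadmissibility criterion (SELECTION-LAW-PROOF v3 §5, `amend12.py`), in Part I's vocabulary. -/
theorem excess_nonneg_iff (h : LevelBox p R0 r) (hm : 2 ≤ m) (hu1 : -p ≤ u) (hu2 : u ≤ p) :
    (∀ ℓ, 0 ≤ excess p R0 m r ℓ u) ↔ (¬ R0 < u ∧ ¬ u < -R0 ∧ reachL p r u = 0 ∧ reachR p r u = 0) := by
  have cL := countGe_nonneg r (3 * p + u)
  have cR := countGe_nonneg r (3 * p - u)
  have iL := indic_nonneg (R0 < u)
  have iR := indic_nonneg (u < -R0)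
  constructor
  · intro hall
    have e0 := hall 0
    have e1 := hall (m - 2)
    have e2 := hall (3 * m - 2)
    have e3 := hall (2 * m)
    rw [excess_zeroLo h hu1 hu2 le_rfl (by omega), if_pos rfl] at e0
    rw [excess_zeroLo h hu1 hu2 (by omega) le_rfl] at e1
    rw [excess_zeroHi h hu1 hu2 (by omega) le_rfl, if_pos rfl] at e2
    rw [excess_zeroHi h hu1 hu2 le_rfl (by omega)] at e3
    simp only [if_true] at e1 e3
    unfold reachL reachR at *
    refine ⟨fun hc => ?_, fun hc => ?_, ?_, ?_⟩
    · rw [indic_pos hc] at e0; split_ifs at e0 <;> omega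
    · rw [indic_pos hc] at e2; split_ifs at e2 <;> omega
    · split_ifs at e1 <;> omega
    · split_ifs at e3 <;> omega
  · rintro ⟨h1, h2, h3, h4⟩ ℓ
    have cLt := countLt_nonneg r (u + p)
    have cLt' := countLt_nonneg r (p - u)
    have i1 := indic_nonneg (2 * p - R0 ≤ u)
    have i2 := indic_nonneg (u ≤ R0 - 2 * p)
    rw [excess_eq_formula h (by omega) hu1 hu2]
    unfold excessFormula L R np nm
    rw [indic_neg h1, indic_neg h2, h3, h4]
    simp only [ite_self, sub_zero]
    split_ifs <;> omega

/-- **THEOREM S (i) AS PRINTED** (`m ≥ 2`, admissible class): the class polynomial is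
`(ζ+m/2)^L (ζ−m/2)^R (ζ−3m/2)^{n₊} (ζ+3m/2)^{n₋}` — excess `L, R, n₊, n₋` at the levels `m−1, 2m−1, 3m−1, −1` and 0 elsewhere. -/
theorem excess_of_admissible (h : LevelBox p R0 r) (hm : 2 ≤ m) (hu1 : -p ≤ u) (hu2 : u ≤ p)
    (hadm : ¬ R0 < u ∧ ¬ u < -R0 ∧ reachL p r u = 0 ∧ reachR p r u = 0) (ℓ : ℤ) :
    excess p R0 m r ℓ u =
      if ℓ = m - 1 then L p r u else if ℓ = 2 * m - 1 then R p r u else if ℓ = 3 * m - 1 then np p R0 u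
      else if ℓ = -1 then nm p R0 u else 0 := by
  obtain ⟨h1, h2, h3, h4⟩ := hadm
  rw [excess_eq_formula h (by omega) hu1 hu2]
  unfold excessFormula
  rw [indic_neg h1, indic_neg h2, h3, h4]
  simp only [ite_self, sub_zero]
  by_cases c1 : ℓ = m - 1 <;> by_cases c2 : ℓ = 2 * m - 1 <;> by_cases c3 : ℓ = 3 * m - 1 <;> by_cases c4 : ℓ = -1 <;>
    simp (disch := omega) only [if_pos, if_neg] <;> omega

/-- **THEOREM S (i′) = A1/A2** (`m = 1`, every class): excess `L_A, R_A, n₊A, n₋A` (Part I's amended exponents) at the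
levels `0, 1, 2, −1`, and 0 elsewhere. -/
theorem excess_m_one (h : LevelBox p R0 r) (hu1 : -p ≤ u) (hu2 : u ≤ p) (ℓ : ℤ) :
    excess p R0 1 r ℓ u =
      if ℓ = 0 then LA p R0 r u else if ℓ = 1 then RA p R0 r u else if ℓ = 2 then npA p R0 r u
      else if ℓ = -1 then nmA p R0 r u else 0 := by
  rw [excess_eq_formula h le_rfl hu1 hu2]
  unfold excessFormula LA RA npA nmA
  by_cases c1 : ℓ = 0 <;> by_cases c2 : ℓ = 1 <;> by_cases c3 : ℓ = 2 <;> by_cases c4 : ℓ = -1 <;>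
    simp (disch := omega) only [if_pos, if_neg] <;> omega

/-- at `m = 1` every class of a DEEP cell is admissible (Part I's `admissible_m1`): no over-covered level. -/
theorem DeepCell.excess_nonneg_m_one {p R0 : ℤ} {r : Fin 7 → ℤ} (h : DeepCell p R0 r) {u : ℤ} (hc : IsClass p R0 u)
    (ℓ : ℤ) : 0 ≤ excess p R0 1 r ℓ u := by
  obtain ⟨a1, a2, a3, a4⟩ := h.admissible_m1 hc
  rw [excess_m_one h.levelBox (by linarith [hc.1]) hc.2.1]
  split_ifs <;> omega

end Admissible

/-! ### Corollary on deep cells: U″-open-3 («δ ≤ 4 and no over-covered level») -/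

namespace DeepCell
variable {p R0 : ℤ} {r : Fin 7 → ℤ} {u : ℤ}

/-- a dominant class (un-amended score) of a deep cell is admissible in the `m ≥ 2` sense: `|u| ≤ R₀`, no reaching block. -/
theorem dominant_admissible (h : DeepCell p R0 r) (hd : IsDominant p R0 r u) :
    ¬ R0 < u ∧ ¬ u < -R0 ∧ reachL p r u = 0 ∧ reachR p r u = 0 := by
  by_cases h1 : R0 < u
  · exact absurd hd (h.not_dominant_of_nonadmissible (Or.inl h1))
  by_cases h2 : u < -R0
  · exact absurd hd (h.not_dominant_of_nonadmissible (Or.inr (Or.inl h2)))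
  by_cases h3 : 1 ≤ reachR p r u
  · exact absurd hd (h.not_dominant_of_nonadmissible (Or.inr (Or.inr (Or.inl h3))))
  by_cases h4 : 1 ≤ reachL p r u
  · exact absurd hd (h.not_dominant_of_nonadmissible (Or.inr (Or.inr (Or.inr h4))))
  have cL := countGe_nonneg r (3 * p + u)
  have cR := countGe_nonneg r (3 * p - u)
  unfold reachL reachR at *
  exact ⟨h1, h2, by omega, by omega⟩

/-- the same for the amended score. -/
theorem dominantA_admissible (h : DeepCell p R0 r) (hd : IsDominantA p R0 r u) :
    ¬ R0 < u ∧ ¬ u < -R0 ∧ reachL p r u = 0 ∧ reachR p r u = 0 := by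
  by_cases h1 : R0 < u
  · exact absurd hd (h.not_dominantA_of_A1A2 (Or.inl h1))
  by_cases h2 : u < -R0
  · exact absurd hd (h.not_dominantA_of_A1A2 (Or.inr (Or.inl h2)))
  by_cases h3 : 1 ≤ reachR p r u
  · exact absurd hd (h.not_dominantA_of_A1A2 (Or.inr (Or.inr (Or.inl h3))))
  by_cases h4 : 1 ≤ reachL p r u
  · exact absurd hd (h.not_dominantA_of_A1A2 (Or.inr (Or.inr (Or.inr h4))))
  have cL := countGe_nonneg r (3 * p + u)
  have cR := countGe_nonneg r (3 * p - u)
  unfold reachL reachR at *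
  exact ⟨h1, h2, by omega, by omega⟩

/-- dichotomy used below: a class is admissible (`m ≥ 2` sense) or it is an A1/A2 class. -/
theorem adm_or_not (p R0 : ℤ) (r : Fin 7 → ℤ) (u : ℤ) :
    (¬ R0 < u ∧ ¬ u < -R0 ∧ reachR p r u = 0 ∧ reachL p r u = 0) ∨
    (R0 < u ∨ u < -R0 ∨ 1 ≤ reachR p r u ∨ 1 ≤ reachL p r u) := by
  have cL := countGe_nonneg r (3 * p + u)
  have cR := countGe_nonneg r (3 * p - u)
  unfold reachL reachR at *
  by_cases h1 : R0 < u
  · exact Or.inr (Or.inl h1)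
  by_cases h2 : u < -R0
  · exact Or.inr (Or.inr (Or.inl h2))
  by_cases h3 : 1 ≤ countGe r (3 * p - u)
  · exact Or.inr (Or.inr (Or.inr (Or.inl h3)))
  by_cases h4 : 1 ≤ countGe r (3 * p + u)
  · exact Or.inr (Or.inr (Or.inr (Or.inr h4)))
  exact Or.inl ⟨h1, h2, by omega, by omega⟩

/-- **THE TWO DOMINANCE NOTIONS OF PART I COINCIDE ON DEEP CELLS**: `argmin (δ + [centre]) = argmin (δ_A + [centre])`
(both minima are `≤ 4` by `u*`, A1/A2 classes score `≥ 5` for both, and `δ_A = δ` elsewhere) — so the census weight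
`δ_A + [centre] − (4m+8)` of `sum_ord` and the engine's threshold score select the same classes at every octave. -/
theorem isDominant_iff_isDominantA (h : DeepCell p R0 r) : IsDominant p R0 r u ↔ IsDominantA p R0 r u := by
  have hstar := h.score_utStar_le_four
  have hstarc := h.utStar_isClass
  have key : ∀ v, IsClass p R0 v → (scoreA p R0 r v = score p R0 r v) ∨ (5 ≤ scoreA p R0 r v) := fun v hv => by
    rcases adm_or_not p R0 r v with ⟨a1, a2, a3, a4⟩ | hA
    · left; unfold scoreA score; rw [deltaA_eq_delta a1 a2 a3 a4]
    · right
      have h5 : 5 ≤ deltaA p R0 r v := by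
        rcases hA with hA | hA | hA | hA
        · linarith [h.six_le_deltaA_of_A2 hv (Or.inl hA)]
        · linarith [h.six_le_deltaA_of_A2 hv (Or.inr hA)]
        · exact h.five_le_deltaA_of_A1 hv (Or.inl hA)
        · exact h.five_le_deltaA_of_A1 hv (Or.inr hA)
      have := indic_nonneg (v = 0 ∨ v = p)
      unfold scoreA centre; linarith
  have le : ∀ v, scoreA p R0 r v ≤ score p R0 r v := fun v => by
    unfold scoreA score; linarith [deltaA_le_delta p R0 r v]
  constructor
  · rintro ⟨hc, hmin⟩
    have hu4 : score p R0 r u ≤ 4 := le_trans (hmin _ hstarc) hstar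
    have hequ : scoreA p R0 r u = score p R0 r u := by
      rcases key u hc with e | e
      · exact e
      · linarith [le u]
    refine ⟨hc, fun v hv => ?_⟩
    rcases key v hv with e | e
    · rw [hequ, e]; exact hmin v hv
    · linarith
  · rintro ⟨hc, hmin⟩
    have hu4 : scoreA p R0 r u ≤ 4 := le_trans (hmin _ hstarc) (le_trans (le _) hstar)
    have hequ : scoreA p R0 r u = score p R0 r u := by
      rcases key u hc with e | e
      · exact e
      · linarith
    refine ⟨hc, fun v hv => ?_⟩
    rcases key v hv with e | e
    · rw [← hequ, ← e]; exact hmin v hv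
    · linarith [le v]

/-- **U″-open-3, first half — NO OVER-COVERED LEVEL**: a dominant class of a deep cell has excess `≥ 0` at every level,
at EVERY octave `m ≥ 1` (its level function is `P_x · T_m` with `P_x` a genuine polynomial). -/
theorem dominant_excess_nonneg (h : DeepCell p R0 r) (hd : IsDominant p R0 r u) {m : ℤ} (hm : 1 ≤ m) (ℓ : ℤ) :
    0 ≤ excess p R0 m r ℓ u := by
  have hu1 : -p ≤ u := by linarith [hd.1.1]
  have hu2 : u ≤ p := hd.1.2.1
  by_cases hm1 : m = 1
  · subst hm1; exact h.excess_nonneg_m_one hd.1 ℓ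
  · exact (excess_nonneg_iff h.levelBox (by omega) hu1 hu2).2 (h.dominant_admissible hd) ℓ

/-- **U″-open-3, second half — THEOREM S (i) AS PRINTED ON DOMINANT CLASSES, ALL OCTAVES**: for a dominant class of a
deep cell the excess is `L, R, n₊, n₋` at the levels `m−1, 2m−1, 3m−1, −1` (roots `ζ = −m/2, +m/2, +3m/2, −3m/2`, all root
offsets 0) and 0 elsewhere — at `m = 1` too (the amendments A1/A2 are void on dominant classes). -/
theorem dominant_excess_eq (h : DeepCell p R0 r) (hd : IsDominant p R0 r u) {m : ℤ} (hm : 1 ≤ m) (ℓ : ℤ) :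
    excess p R0 m r ℓ u =
      if ℓ = m - 1 then L p r u else if ℓ = 2 * m - 1 then R p r u else if ℓ = 3 * m - 1 then np p R0 u
      else if ℓ = -1 then nm p R0 u else 0 := by
  have hu1 : -p ≤ u := by linarith [hd.1.1]
  have hu2 : u ≤ p := hd.1.2.1
  obtain ⟨h1, h2, h3, h4⟩ := h.dominant_admissible hd
  rw [excess_eq_formula h.levelBox hm hu1 hu2]
  unfold excessFormula
  rw [indic_neg h1, indic_neg h2, h3, h4]
  simp only [ite_self, sub_zero]
  by_cases c1 : ℓ = m - 1 <;> by_cases c2 : ℓ = 2 * m - 1 <;> by_cases c3 : ℓ = 3 * m - 1 <;> by_cases c4 : ℓ = -1 <;>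
    simp (disch := omega) only [if_pos, if_neg] <;> omega

/-- **U″-open-3, the degree — `δ ≤ 4`**: for a dominant class of a deep cell the total excess (degree of `P_x`) is
`Σ_ℓ E = δ_A = δ ≤ 4` at every octave, and the class carries `4m + 8 − δ ≥ 4m + 4` net poles. -/
theorem dominant_sum_excess (h : DeepCell p R0 r) (hd : IsDominant p R0 r u) {m : ℤ} (hm : 1 ≤ m) :
    (∑ ℓ ∈ levels m, excess p R0 m r ℓ u) = delta p R0 r u ∧ delta p R0 r u ≤ 4 ∧
    (∑ ℓ ∈ levels m, ord p R0 m r ℓ u) = 4 * m + 8 - delta p R0 r u := by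
  have hu1 : -p ≤ u := by linarith [hd.1.1]
  have hu2 : u ≤ p := hd.1.2.1
  obtain ⟨h1, h2, h3, h4⟩ := h.dominant_admissible hd
  have e := deltaA_eq_delta h1 h2 h4 h3
  refine ⟨?_, h.dominant_delta_le_four hd, ?_⟩
  · rw [sum_excess h.levelBox hm hu1 hu2, e]
  · rw [sum_ord h.levelBox hm hu1 hu2, e]

end DeepCell

/-! ### The dictionary: levels × classes ↔ integers, blocks ↔ `BlockCov`, numerator ↔ `NumCov`, centre-zero -/

end Summit.KontsevichZagierPeriods.Zeta5Search.DenomLaw.ThresholdModel.Rho
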